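import Mathlib.Analysis.Calculus.FDeriv.Prod
import Mathlib.Analysis.Calculus.Deriv.Comp
import Mathlib.LinearAlgebra.Matrix.SchurComplement
import Mathlib.Topology.Algebra.Module.Determinant
import Summits.AtomisticToContinuum.BoseEinsteinCondensation.Theorems.BECThomsonPrincipleDensityResponseDefs
import Summits.AtomisticToContinuum.BoseEinsteinCondensation.Theorems.BECThomsonPrincipleDensityResponseAngleFlow

/-!
# Route `BECThomsonPrinciple`, crux `DensityResponse` (stmt-AtomisticToContinuum-9481),
# line `force-balance-constitutive` — sub-goal `stub_transportFlow` of stub S1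
# (`TransportStationary`)

The CONFIGURATION-SPACE TRANSPORT FLOW of the transport step of S1. Every boson is moved along
the wave vector `k = 2πn/L` by the closed-form angle flow `δ = angleFlow` of `θ' = sin θ`
(`Theorems/BECThomsonPrincipleDensityResponseAngleFlow.lean`) acting on its phase `θᵢ = k·xᵢ`:

  `F_τ(X)ᵢ = xᵢ + (δ(τ, k·xᵢ) / |k|²) · k`        (`transportFlow L n τ X`),

the time-`τ` flow of the displacement field `U = (u_k(x₁), …, u_k(x_N))`,
`u_k(x) = k sin(k·x)/|k|²`.
Contents (all elementary; no named facts):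

* `kdual L n : ℝ³ →L[ℝ] ℝ`, the phase functional `x ↦ k·x` (`phase L n X i = kdual L n (X i)` by
  `rfl`), `kdual L n (kvec L n) = ksq L n`, `0 < ksq L n` for `L ≠ 0`, `n ≠ 0`;
* phase transport `k·F_τ(X)ᵢ = θᵢ + δ(τ, θᵢ)` (for `|k|² ≠ 0`);
* the flow law `F_τ ∘ F_σ = F_{τ+σ}`, `F_0 = id`, the inverse `F_{-τ}`, the `Equiv` `transportEquiv`
  and bijectivity (unconditional: for `|k|² = 0`, i.e. `n = 0` or `L = 0`, the flow is the
  identity);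
* smoothness `ContDiff ℝ m` in `X` and jointly in `(τ, X)`, and the `τ`-derivative
  `∂_τ F_τ(X)ᵢ = (sin(θᵢ + δ(τ, θᵢ)) / |k|²) · k = u_k(F_τ(X)ᵢ)`;
* lattice equivariance `F_τ(X + L e_{i,c}) = F_τ(X) + L e_{i,c}` (the phase of particle `i` moves by
  `2π n_c`) and permutation equivariance `F_τ(X ∘ σ) = F_τ(X) ∘ σ`;
* the Fréchet derivative `HasFDerivAt (F_τ) (transportDeriv L n τ X) X`, block diagonal over the
  particles with one-particle blocks `transportBlock L n τ θᵢ = 1 + ((D(τ,θᵢ)⁻¹ - 1)/|k|²) k ⊗ k`,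
  `D(τ, θ) = cosh τ - cos θ sinh τ`, and its determinant
  `det (transportDeriv L n τ X) = ∏ᵢ D(τ, θᵢ)⁻¹ > 0` (matrix determinant lemma
  `det (1 + u ⊗ φ) = 1 + φ(u)` per block, `ContinuousLinearMap.det_pi` across blocks).

These are exactly the hypotheses of the torus change-of-variables theorem for lattice-equivariant
`C¹` diffeomorphisms, consumed by the transported state `Φ^τ = (Φ ∘ F_{-τ}) · (det DF_{-τ})^{1/2}`.
The registered sub-goal `stub_transportFlow` packages the listed properties.
-/

namespace Summit.AtomisticToContinuum.BoseEinsteinCondensation.Cruxes.DensityResponse.ForceBalanceConstitutive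

noncomputable section

open Real
open Literature.MathematicalPhysics.QuantumManyBody.BoseGas

variable {N : ℕ}

/-! ### The phase functional `k·x` and `|k|²` -/

/-- The phase functional `x ↦ k·x = (2π/L) ∑ⱼ nⱼ xⱼ` on `ℝ³` as a continuous linear form, written so
that `phase L n X i = kdual L n (X i)` holds by `rfl`. -/
def kdual (L : ℝ) (n : Fin 3 → ℤ) : Space →L[ℝ] ℝ where
  toFun x := 2 * π / L * ∑ j, (n j : ℝ) * x j
  map_add' x y := by
    simp only [PiLp.add_apply, mul_add, Finset.sum_add_distrib]
  map_smul' c x := by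
    simp only [PiLp.smul_apply, smul_eq_mul, RingHom.id_apply, Finset.mul_sum]
    exact Finset.sum_congr rfl fun j _ => by ring
  cont := by
    show Continuous fun x : Space => 2 * π / L * ∑ j, (n j : ℝ) * x j
    fun_prop

/-- `phase L n X i = k·xᵢ = kdual L n (X i)`. [folklore] -/
theorem phase_eq_kdual (L : ℝ) (n : Fin 3 → ℤ) (X : Config N) (i : Fin N) :
    phase L n X i = kdual L n (X i) := rfl

/-- `k·k = |k|²`. [folklore] -/
theorem kdual_kvec (L : ℝ) (n : Fin 3 → ℤ) : kdual L n (kvec L n) = ksq L n := by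
  show 2 * π / L * ∑ j, (n j : ℝ) * (2 * π / L * (n j : ℝ)) = (2 * π / L) ^ 2 * ∑ j, (n j : ℝ) ^ 2
  rw [Finset.mul_sum, Finset.mul_sum]
  exact Finset.sum_congr rfl fun j _ => by ring

/-- `|k|² > 0` for a genuine box (`L ≠ 0`) and a genuine mode (`n ≠ 0`). [folklore] -/
theorem ksq_pos {L : ℝ} {n : Fin 3 → ℤ} (hL : L ≠ 0) (hn : n ≠ 0) : 0 < ksq L n := by
  obtain ⟨j, hj⟩ := Function.ne_iff.mp hn
  have hj' : (n j : ℝ) ≠ 0 := Int.cast_ne_zero.mpr hj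
  unfold ksq
  refine mul_pos (by positivity) (lt_of_lt_of_le (by positivity : (0 : ℝ) < (n j : ℝ) ^ 2) ?_)
  exact Finset.single_le_sum (f := fun j => (n j : ℝ) ^ 2) (fun j _ => sq_nonneg _)
    (Finset.mem_univ j)

/-- `|k|² ≠ 0` forces `L ≠ 0` (Lean's `2π/0 = 0`). [folklore] -/
theorem ne_zero_of_ksq_ne_zero {L : ℝ} {n : Fin 3 → ℤ} (hk : ksq L n ≠ 0) : L ≠ 0 := by
  rintro rfl
  exact hk (by simp [ksq])

/-! ### The transport flow -/

/-- The TRANSPORT FLOW `F_τ(X)ᵢ = xᵢ + (δ(τ, k·xᵢ)/|k|²)·k`: every boson is moved along `k` so that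
its phase `θᵢ = k·xᵢ` follows the angle flow of `θ' = sin θ` for time `τ` (the flow of the
displacement field `(u_k(x₁), …, u_k(x_N))`, `u_k(x) = k sin(k·x)/|k|²`). The identity for
`|k|² = 0`. -/
def transportFlow (L : ℝ) (n : Fin 3 → ℤ) (τ : ℝ) (X : Config N) : Config N :=
  fun i => X i + (angleFlow τ (phase L n X i) / ksq L n) • kvec L n

/-- Unfolding `transportFlow` at a particle. [folklore] -/
theorem transportFlow_apply (L : ℝ) (n : Fin 3 → ℤ) (τ : ℝ) (X : Config N) (i : Fin N) :
    transportFlow L n τ X i = X i + (angleFlow τ (phase L n X i) / ksq L n) • kvec L n := rfl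

/-- Degenerate case: for `|k|² = 0` the flow is the identity. [folklore] -/
theorem transportFlow_of_ksq_eq_zero {L : ℝ} {n : Fin 3 → ℤ} (hk : ksq L n = 0) (τ : ℝ)
    (X : Config N) : transportFlow L n τ X = X := by
  funext i
  rw [transportFlow_apply, hk, div_zero, zero_smul, add_zero]

/-- PHASE TRANSPORT: `k·F_τ(X)ᵢ = θᵢ + δ(τ, θᵢ)`. [folklore] -/
theorem phase_transportFlow {L : ℝ} {n : Fin 3 → ℤ} (hk : ksq L n ≠ 0) (τ : ℝ) (X : Config N)
    (i : Fin N) :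
    phase L n (transportFlow L n τ X) i = phase L n X i + angleFlow τ (phase L n X i) := by
  rw [phase_eq_kdual, transportFlow_apply, map_add, map_smul, kdual_kvec, smul_eq_mul,
    div_mul_cancel₀ _ hk, ← phase_eq_kdual]

/-- `F_0 = id`. [folklore] -/
theorem transportFlow_zero (L : ℝ) (n : Fin 3 → ℤ) (X : Config N) : transportFlow L n 0 X = X := by
  funext i
  rw [transportFlow_apply, angleFlow_zero, zero_div, zero_smul, add_zero]

/-- The FLOW LAW `F_τ ∘ F_σ = F_{τ+σ}` (from the flow law of the angle flow). [folklore] -/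
theorem transportFlow_add (L : ℝ) (n : Fin 3 → ℤ) (τ σ : ℝ) (X : Config N) :
    transportFlow L n τ (transportFlow L n σ X) = transportFlow L n (τ + σ) X := by
  by_cases hk : ksq L n = 0
  · simp only [transportFlow_of_ksq_eq_zero hk]
  funext i
  simp only [transportFlow_apply, phase_transportFlow hk]
  rw [angleFlow_add τ σ, add_div, add_smul, add_assoc]

/-- `F_{-τ} ∘ F_τ = id`. [folklore] -/
theorem transportFlow_neg_transportFlow (L : ℝ) (n : Fin 3 → ℤ) (τ : ℝ) (X : Config N) :
    transportFlow L n (-τ) (transportFlow L n τ X) = X := by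
  rw [transportFlow_add, neg_add_cancel, transportFlow_zero]

/-- `F_τ ∘ F_{-τ} = id`. [folklore] -/
theorem transportFlow_transportFlow_neg (L : ℝ) (n : Fin 3 → ℤ) (τ : ℝ) (X : Config N) :
    transportFlow L n τ (transportFlow L n (-τ) X) = X := by
  rw [transportFlow_add, add_neg_cancel, transportFlow_zero]

/-- The flow map at time `τ` as a bijection of configuration space, with inverse `F_{-τ}`. -/
def transportEquiv (L : ℝ) (n : Fin 3 → ℤ) (τ : ℝ) : Config N ≃ Config N where
  toFun := transportFlow L n τ
  invFun := transportFlow L n (-τ)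
  left_inv := transportFlow_neg_transportFlow L n τ
  right_inv := transportFlow_transportFlow_neg L n τ

/-- `F_τ` is a bijection of `(ℝ³)^N`. [folklore] -/
theorem bijective_transportFlow (L : ℝ) (n : Fin 3 → ℤ) (τ : ℝ) :
    Function.Bijective (transportFlow (N := N) L n τ) :=
  (transportEquiv L n τ).bijective

/-! ### Smoothness -/

/-- `θ ↦ δ(τ, θ)` is smooth. [folklore] -/
theorem contDiff_angleFlow_right (τ : ℝ) {m : WithTop ℕ∞} :
    ContDiff ℝ m fun θ : ℝ => angleFlow τ θ := by
  have h : ContDiff ℝ m ((fun p : ℝ × ℝ => angleFlow p.1 p.2) ∘ fun θ : ℝ => (τ, θ)) :=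
    contDiff_angleFlow.comp (contDiff_const.prodMk contDiff_id)
  exact h

/-- `X ↦ θᵢ(X) = k·xᵢ` is smooth (linear). [folklore] -/
theorem contDiff_phase (L : ℝ) (n : Fin 3 → ℤ) (i : Fin N) {m : WithTop ℕ∞} :
    ContDiff ℝ m fun X : Config N => phase L n X i :=
  (kdual L n).contDiff.comp (contDiff_apply ℝ Space i)

/-- `F_τ` is `C^m` for every `m` (in particular `C¹`). [folklore] -/
theorem contDiff_transportFlow (L : ℝ) (n : Fin 3 → ℤ) (τ : ℝ) {m : WithTop ℕ∞} :
    ContDiff ℝ m (transportFlow (N := N) L n τ) := by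
  refine contDiff_pi.2 fun i => ?_
  show ContDiff ℝ m fun X : Config N => X i + (angleFlow τ (phase L n X i) / ksq L n) • kvec L n
  have h : ContDiff ℝ m ((fun θ : ℝ => angleFlow τ θ) ∘ fun X : Config N => phase L n X i) :=
    (contDiff_angleFlow_right τ).comp (contDiff_phase L n i)
  exact (contDiff_apply ℝ Space i).add ((h.div_const _).smul contDiff_const)

/-- Joint smoothness of `(τ, X) ↦ F_τ(X)`. [folklore] -/
theorem contDiff_transportFlow_uncurry (L : ℝ) (n : Fin 3 → ℤ) {m : WithTop ℕ∞} :
    ContDiff ℝ m fun p : ℝ × Config N => transportFlow L n p.1 p.2 := by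
  refine contDiff_pi.2 fun i => ?_
  show ContDiff ℝ m fun p : ℝ × Config N =>
    p.2 i + (angleFlow p.1 (kdual L n (p.2 i)) / ksq L n) • kvec L n
  have h2 : ContDiff ℝ m fun p : ℝ × Config N => p.2 i :=
    (contDiff_apply ℝ Space i).comp contDiff_snd
  have h : ContDiff ℝ m ((fun q : ℝ × ℝ => angleFlow q.1 q.2) ∘ fun p : ℝ × Config N =>
      (p.1, kdual L n (p.2 i))) :=
    contDiff_angleFlow.comp (contDiff_fst.prodMk ((kdual L n).contDiff.comp h2))
  exact h2.add ((h.div_const _).smul contDiff_const)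

/-- The flow equation, particle by particle: `∂_τ F_τ(X)ᵢ = (sin(θᵢ + δ(τ, θᵢ))/|k|²)·k`
(`= u_k(F_τ(X)ᵢ)` by phase transport). [folklore] -/
theorem hasDerivAt_transportFlow (L : ℝ) (n : Fin 3 → ℤ) (τ : ℝ) (X : Config N) (i : Fin N) :
    HasDerivAt (fun t => transportFlow L n t X i)
      ((sin (phase L n X i + angleFlow τ (phase L n X i)) / ksq L n) • kvec L n) τ :=
  (((hasDerivAt_angleFlow τ _).div_const _).smul_const _).const_add _

/-- The flow equation in autonomous form: `∂_τ F_τ(X)ᵢ = u_k(F_τ(X)ᵢ)`,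
`u_k(x) = (sin(k·x)/|k|²) k` (for `|k|² ≠ 0`). [folklore] -/
theorem hasDerivAt_transportFlow_eq_field {L : ℝ} {n : Fin 3 → ℤ} (hk : ksq L n ≠ 0) (τ : ℝ)
    (X : Config N) (i : Fin N) :
    HasDerivAt (fun t => transportFlow L n t X i)
      ((sin (phase L n (transportFlow L n τ X) i) / ksq L n) • kvec L n) τ := by
  rw [phase_transportFlow hk]
  exact hasDerivAt_transportFlow L n τ X i

/-- The flow equation for the whole configuration. [folklore] -/
theorem hasDerivAt_transportFlow_pi (L : ℝ) (n : Fin 3 → ℤ) (τ : ℝ) (X : Config N) :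
    HasDerivAt (fun t => transportFlow L n t X)
      (fun i => (sin (phase L n X i + angleFlow τ (phase L n X i)) / ksq L n) • kvec L n) τ :=
  hasDerivAt_pi.2 fun i => hasDerivAt_transportFlow L n τ X i

/-! ### Lattice and permutation equivariance -/

/-- Adding the lattice generator `L e_{i,c}` moves the phase of particle `i'` by an integer multiple
of `2π` (`n_c` if `i' = i` and `L ≠ 0`, else `0`). [folklore] -/
theorem exists_phase_add_single (L : ℝ) (n : Fin 3 → ℤ) (X : Config N) (i : Fin N) (c : Fin 3)
    (i' : Fin N) : ∃ m : ℤ, phase L n (X + Pi.single i (EuclideanSpace.single c L)) i' =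
      phase L n X i' + m * (2 * π) := by
  rw [phase_eq_kdual, phase_eq_kdual, Pi.add_apply, map_add]
  rcases eq_or_ne i' i with rfl | h
  · rcases eq_or_ne L 0 with rfl | hL
    · refine ⟨0, ?_⟩
      have h0 : ∀ y : Space, kdual (0 : ℝ) n y = 0 := fun y => by
        show 2 * π / 0 * _ = 0
        rw [div_zero, zero_mul]
      rw [h0, h0, Int.cast_zero, zero_mul]
    · refine ⟨n c, ?_⟩
      rw [Pi.single_eq_same]
      congr 1
      show 2 * π / L * ∑ j, (n j : ℝ) * EuclideanSpace.single c L j = ((n c : ℤ) : ℝ) * (2 * π)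
      simp only [PiLp.single_apply, mul_ite, mul_zero, Finset.sum_ite_eq', Finset.mem_univ,
        if_true]
      rw [mul_comm (n c : ℝ) L, ← mul_assoc, div_mul_cancel₀ _ hL, mul_comm]
  · exact ⟨0, by rw [Pi.single_eq_of_ne h, map_zero, Int.cast_zero, zero_mul]⟩

/-- LATTICE EQUIVARIANCE: `F_τ(X + L e_{i,c}) = F_τ(X) + L e_{i,c}`. [folklore] -/
theorem transportFlow_add_single (L : ℝ) (n : Fin 3 → ℤ) (τ : ℝ) (X : Config N) (i : Fin N)
    (c : Fin 3) :
    transportFlow L n τ (X + Pi.single i (EuclideanSpace.single c L)) =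
      transportFlow L n τ X + Pi.single i (EuclideanSpace.single c L) := by
  funext i'
  obtain ⟨m, hm⟩ := exists_phase_add_single L n X i c i'
  rw [transportFlow_apply, hm, angleFlow_add_int_mul_two_pi, Pi.add_apply, Pi.add_apply,
    transportFlow_apply, add_right_comm]

/-- PERMUTATION EQUIVARIANCE: `F_τ(X ∘ σ) = F_τ(X) ∘ σ`. [folklore] -/
theorem transportFlow_comp_perm (L : ℝ) (n : Fin 3 → ℤ) (τ : ℝ) (σ : Equiv.Perm (Fin N))
    (X : Config N) : transportFlow L n τ (X ∘ σ) = transportFlow L n τ X ∘ σ := rfl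

/-! ### The Fréchet derivative and its determinant -/

/-- The one-particle Jacobian matrix of `F_τ` at phase `θ`:
`1 + ((D(τ,θ)⁻¹ - 1)/|k|²) k ⊗ k`, `D(τ, θ) = cosh τ - cos θ sinh τ`
(identity across `k`, dilation by `D⁻¹ = ∂_θ(θ + δ)` along `k`). -/
def transportBlock (L : ℝ) (n : Fin 3 → ℤ) (τ θ : ℝ) : Space →L[ℝ] Space :=
  ContinuousLinearMap.id ℝ Space +
    ((((cosh τ - cos θ * sinh τ)⁻¹ - 1) / ksq L n) • kdual L n).smulRight (kvec L n)

/-- Unfolding `transportBlock`. [folklore] -/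
theorem transportBlock_apply (L : ℝ) (n : Fin 3 → ℤ) (τ θ : ℝ) (v : Space) :
    transportBlock L n τ θ v =
      v + (((cosh τ - cos θ * sinh τ)⁻¹ - 1) / ksq L n * kdual L n v) • kvec L n := rfl

/-- The Jacobian matrix `DF_τ(X)` of the transport flow: block diagonal over the particles with
blocks `transportBlock L n τ θᵢ`. -/
def transportDeriv (L : ℝ) (n : Fin 3 → ℤ) (τ : ℝ) (X : Config N) : Config N →L[ℝ] Config N :=
  ContinuousLinearMap.pi fun i =>
    (transportBlock L n τ (phase L n X i)).comp (ContinuousLinearMap.proj i)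

/-- Unfolding `transportDeriv`: `(DF_τ(X) V)ᵢ = Vᵢ + ((D(τ,θᵢ)⁻¹ - 1)/|k|²)(k·Vᵢ) k`. [folklore] -/
theorem transportDeriv_apply (L : ℝ) (n : Fin 3 → ℤ) (τ : ℝ) (X V : Config N) (i : Fin N) :
    transportDeriv L n τ X V i = V i +
      (((cosh τ - cos (phase L n X i) * sinh τ)⁻¹ - 1) / ksq L n * phase L n V i) • kvec L n :=
  rfl

/-- The one-particle map `y ↦ y + (δ(τ, k·y)/|k|²)·k` has derivative `transportBlock L n τ (k·y)`
(chain rule with `∂_θ δ = D⁻¹ - 1`). [folklore] -/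
theorem hasFDerivAt_transportBlock (L : ℝ) (n : Fin 3 → ℤ) (τ : ℝ) (x : Space) :
    HasFDerivAt (fun y : Space => y + (angleFlow τ (kdual L n y) / ksq L n) • kvec L n)
      (transportBlock L n τ (kdual L n x)) x :=
  (hasFDerivAt_id x).add
    ((((hasDerivAt_angleFlow_theta τ (kdual L n x)).div_const (ksq L n)).comp_hasFDerivAt x
      (kdual L n).hasFDerivAt).smul_const (kvec L n))

/-- THE FRÉCHET DERIVATIVE of the transport flow: `DF_τ(X) = transportDeriv L n τ X`. [folklore] -/
theorem hasFDerivAt_transportFlow (L : ℝ) (n : Fin 3 → ℤ) (τ : ℝ) (X : Config N) :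
    HasFDerivAt (transportFlow L n τ) (transportDeriv L n τ X) X :=
by
  refine hasFDerivAt_pi.2 fun i => ?_
  have h : HasFDerivAt (fun Y : Config N => Y i) (ContinuousLinearMap.proj (R := ℝ) i) X :=
    hasFDerivAt_apply i X
  exact (hasFDerivAt_transportBlock L n τ (X i)).comp X h

/-- The MATRIX DETERMINANT LEMMA for a rank-one perturbation of the identity:
`det (1 + u ⊗ φ) = 1 + φ(u)` (Weinstein–Aronszajn in a basis). [folklore] -/
theorem det_id_add_smulRight {M : Type*} [NormedAddCommGroup M] [NormedSpace ℝ M]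
    [FiniteDimensional ℝ M] (φ : M →L[ℝ] ℝ) (u : M) :
    (ContinuousLinearMap.id ℝ M + φ.smulRight u).det = 1 + φ u := by
  classical
  let b := Module.finBasis ℝ M
  have hc : ((ContinuousLinearMap.id ℝ M + φ.smulRight u : M →L[ℝ] M) : M →ₗ[ℝ] M) =
      LinearMap.id + (φ : M →ₗ[ℝ] ℝ).smulRight u := rfl
  have h : LinearMap.toMatrix b b ((φ : M →ₗ[ℝ] ℝ).smulRight u) =
      Matrix.replicateCol Unit (b.repr u) * Matrix.replicateRow Unit (fun j => φ (b j)) := by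
    rw [← Matrix.vecMulVec_eq Unit]
    ext i j
    rw [LinearMap.toMatrix_apply, Matrix.vecMulVec_apply, LinearMap.smulRight_apply, map_smul,
      Finsupp.smul_apply, smul_eq_mul, mul_comm]
    rfl
  have hsum : (∑ j, φ (b j) * b.repr u j) = φ u := by
    conv_rhs => rw [← b.sum_repr u]
    rw [map_sum]
    exact Finset.sum_congr rfl fun j _ => by rw [map_smul, smul_eq_mul, mul_comm]
  show LinearMap.det ((ContinuousLinearMap.id ℝ M + φ.smulRight u : M →L[ℝ] M) : M →ₗ[ℝ] M) = _
  rw [hc, ← LinearMap.det_toMatrix b, map_add, LinearMap.toMatrix_id, h,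
    Matrix.det_one_add_replicateCol_mul_replicateRow]
  exact congrArg (1 + ·) hsum

/-- `det (transportBlock L n τ θ) = D(τ, θ)⁻¹ = (cosh τ - cos θ sinh τ)⁻¹` (for `|k|² ≠ 0`).
[folklore] -/
theorem det_transportBlock {L : ℝ} {n : Fin 3 → ℤ} (hk : ksq L n ≠ 0) (τ θ : ℝ) :
    (transportBlock L n τ θ).det = (cosh τ - cos θ * sinh τ)⁻¹ := by
  rw [transportBlock, det_id_add_smulRight, smul_apply, kdual_kvec, smul_eq_mul,
    div_mul_cancel₀ _ hk, add_sub_cancel]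

/-- THE JACOBIAN DETERMINANT `det DF_τ(X) = ∏ᵢ (cosh τ - cos θᵢ sinh τ)⁻¹` (block diagonal).
[folklore] -/
theorem det_transportDeriv {L : ℝ} {n : Fin 3 → ℤ} (hk : ksq L n ≠ 0) (τ : ℝ) (X : Config N) :
    (transportDeriv L n τ X).det = ∏ i, (cosh τ - cos (phase L n X i) * sinh τ)⁻¹ := by
  rw [transportDeriv, ContinuousLinearMap.det_pi]
  exact Finset.prod_congr rfl fun i _ => det_transportBlock hk τ _

/-- The Jacobian determinant is positive. [folklore] -/
theorem det_transportDeriv_pos {L : ℝ} {n : Fin 3 → ℤ} (hk : ksq L n ≠ 0) (τ : ℝ) (X : Config N) :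
    0 < (transportDeriv L n τ X).det := by
  rw [det_transportDeriv hk]
  exact Finset.prod_pos fun i _ => inv_pos.mpr (jacFactor_pos τ (phase L n X i))

/-! ### The registered sub-goal -/

/-- **Registered sub-goal `stub_transportFlow` of S1** (line `force-balance-constitutive`, crux
stmt-AtomisticToContinuum-9481): the configuration-space transport flow `F_τ = transportFlow L n τ`
satisfies `F_0 = id`, the flow law `F_τ ∘ F_σ = F_{τ+σ}`, is bijective and `C¹`, is lattice and
permutation equivariant, obeys the flow equation `∂_τ F_τ(X)ᵢ = (sin(θᵢ + δ(τ,θᵢ))/|k|²) k`, has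
Fréchet derivative `transportDeriv L n τ X`, and, for `|k|² ≠ 0`, transports phases by the angle
flow and has Jacobian determinant `∏ᵢ (cosh τ - cos θᵢ sinh τ)⁻¹`. [folklore] -/
theorem stub_transportFlow : ∀ (N : ℕ) (L : ℝ) (n : Fin 3 → ℤ) (τ : ℝ),
    (∀ X : Fin N → EuclideanSpace ℝ (Fin 3), transportFlow L n 0 X = X) ∧
    (∀ (σ : ℝ) (X : Fin N → EuclideanSpace ℝ (Fin 3)),
      transportFlow L n τ (transportFlow L n σ X) = transportFlow L n (τ + σ) X) ∧
    Function.Bijective (transportFlow (N := N) L n τ) ∧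
    ContDiff ℝ 1 (transportFlow (N := N) L n τ) ∧
    (∀ (X : Fin N → EuclideanSpace ℝ (Fin 3)) (i : Fin N) (c : Fin 3),
      transportFlow L n τ (X + Pi.single i (EuclideanSpace.single c L)) =
        transportFlow L n τ X + Pi.single i (EuclideanSpace.single c L)) ∧
    (∀ (σ : Equiv.Perm (Fin N)) (X : Fin N → EuclideanSpace ℝ (Fin 3)),
      transportFlow L n τ (X ∘ σ) = transportFlow L n τ X ∘ σ) ∧
    (∀ (X : Fin N → EuclideanSpace ℝ (Fin 3)) (i : Fin N),
      HasDerivAt (fun t : ℝ => transportFlow L n t X i)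
        ((Real.sin (phase L n X i + angleFlow τ (phase L n X i)) / ksq L n) • kvec L n) τ) ∧
    (∀ X : Fin N → EuclideanSpace ℝ (Fin 3),
      HasFDerivAt (transportFlow L n τ) (transportDeriv L n τ X) X) ∧
    (ksq L n ≠ 0 → (∀ (X : Fin N → EuclideanSpace ℝ (Fin 3)) (i : Fin N),
        phase L n (transportFlow L n τ X) i = phase L n X i + angleFlow τ (phase L n X i)) ∧
      ∀ X : Fin N → EuclideanSpace ℝ (Fin 3), (transportDeriv L n τ X).det =
        ∏ i, (Real.cosh τ - Real.cos (phase L n X i) * Real.sinh τ)⁻¹) :=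
  fun _ L n τ => ⟨transportFlow_zero L n, transportFlow_add L n τ, bijective_transportFlow L n τ,
    contDiff_transportFlow L n τ, transportFlow_add_single L n τ, transportFlow_comp_perm L n τ,
    hasDerivAt_transportFlow L n τ, hasFDerivAt_transportFlow L n τ,
    fun hk => ⟨phase_transportFlow hk τ, det_transportDeriv hk τ⟩⟩

end

end Summit.AtomisticToContinuum.BoseEinsteinCondensation.Cruxes.DensityResponse.ForceBalanceConstitutive
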